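import Literature.Topology.FourManifolds.MappingTorus
import Literature.Topology.FourManifolds.ConnectedSumTransportProofs
import HarnessLib

/-!
# Transport of smooth mapping tori along diffeomorphisms (proofs)

Sibling proofs file of `MappingTorus`: consequences, for the named fact
`Literature.Topology.FourManifolds.IsMappingTorusOf.of_diffeomorph` (transport of `IsMappingTorusOf IT T φ` along a diffeomorphism
`T ≃ₘ⟮IT, IT'⟯ T'`, for two *arbitrary* models `IT`, `IT'` on `ET`), of the corrected and proved
transport of open gluings `Literature.Topology.FourManifolds.IsOpenGluing.diffeomorph_comp` (file
`ConnectedSumTransportProofs`). The interim proof of `IsMappingTorusOf.of_diffeomorph` derived it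
from the named fact `Literature.Topology.FourManifolds.IsOpenGluing.of_diffeomorph`, which is false for two unrelated models
(formal refutation: file `OpenGluingCounterexample`); the derivation goes through under the
hypothesis `range IT' = range IT` (e.g. `IT' = IT`, or both models boundaryless — closed manifolds,
the setting of Cappell–Shaneson). Everything here is a theorem; no statement of `MappingTorus.lean`
is changed:

* `Literature.Topology.FourManifolds.IsMappingTorusOf.of_diffeomorph_of_range_eq` — the corrected statement of the named fact
  (hypothesis `range IT' = range IT` added, `[IsManifold IT ∞ T]` dropped), proved; dot-notation
  form `Literature.IsMappingTorusOf.diffeomorph_comp h e hI` (transport of smooth mapping tori along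
  `e : T ≃ₘ⟮IT, IT'⟯ T'`, i.e. post-composition of the gluing embeddings with `e`);
* `Literature.Topology.FourManifolds.IsMappingTorusOf.diffeomorph_comp_of_boundaryless` — both models boundaryless;
* `Literature.Topology.FourManifolds.IsMappingTorusOf.of_diffeomorph_holds_of_range_eq`, `…_holds_self`,
  `…_holds_of_boundaryless` — the true instances of the named fact
  `Literature.Topology.FourManifolds.IsMappingTorusOf.of_diffeomorph` (fixed models with `range IT' = range IT`, resp.
  `IT' = IT`, resp. both boundaryless), so that consumers carrying it as a hypothesis for such
  models can be fed a proof.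

## References
* S. E. Cappell, J. L. Shaneson, *Some new four-manifolds*, Ann. of Math. 104 (1976), §1.
  [cite: CappellShaneson1976, §1]
* A. Kosinski, *Differential Manifolds*, Academic Press (1993), Ch. VI §1, proof of Thm (1.1).
  [cite: Kosinski1993, Ch. VI §1]
-/

open scoped Manifold ContDiff
open Set

noncomputable section

namespace Literature.Topology.FourManifolds

variable {E H : Type*} [NormedAddCommGroup E] [NormedSpace ℝ E] [TopologicalSpace H]
  {I : ModelWithCorners ℝ E H}
  {ET HT : Type*} [NormedAddCommGroup ET] [NormedSpace ℝ ET] [TopologicalSpace HT]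
  {IT : ModelWithCorners ℝ ET HT}
  {HT' : Type*} [TopologicalSpace HT'] {IT' : ModelWithCorners ℝ ET HT'}
  {M : Type*} [TopologicalSpace M] [ChartedSpace H M]
  {T : Type*} [TopologicalSpace T] [ChartedSpace HT T]
  {T' : Type*} [TopologicalSpace T'] [ChartedSpace HT' T']

/-- **Transport of smooth mapping tori along diffeomorphisms.** If `T` is a smooth mapping torus of
`φ` and `e : T ≃ₘ⟮IT, IT'⟯ T'` is a diffeomorphism onto a `C^∞` manifold whose model has the same
range as `IT` (e.g. `IT' = IT`, or both boundaryless), then `T'` is a smooth mapping torus of `φ`: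
compose the gluing embeddings with `e` (`Literature.Topology.FourManifolds.IsOpenGluing.diffeomorph_comp`;
Cappell–Shaneson 1976, §1; Kosinski, *Differential Manifolds*, VI.1, proof of Thm 1.1). Only
`[IsManifold IT' ∞ T']` is needed. [cite: CappellShaneson1976, §1] -/
theorem IsMappingTorusOf.diffeomorph_comp [IsManifold IT' ∞ T'] {φ : M ≃ₘ⟮I, I⟯ M}
    (h : IsMappingTorusOf IT T φ) (e : T ≃ₘ⟮IT, IT'⟯ T') (hI : range IT' = range IT) :
    IsMappingTorusOf IT' T' φ :=
  IsOpenGluing.diffeomorph_comp h e hI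

/-- **Corrected statement of the named fact `IsMappingTorusOf.of_diffeomorph`, proved**: smooth
mapping tori are transported along diffeomorphisms `T ≃ₘ⟮IT, IT'⟯ T'` onto `C^∞` manifolds whose
model has the same range, `range IT' = range IT` (the original quantifies over two arbitrary models
on `ET`, a generality in which the underlying transport of open gluings is refuted, file
`OpenGluingCounterexample`); the hypothesis `[IsManifold IT ∞ T]` of the original is superfluous.
This is `IsMappingTorusOf.diffeomorph_comp` with the arguments reordered (Cappell–Shaneson 1976,
§1: closed manifolds, one standard model). [cite: CappellShaneson1976, §1] -/
theorem IsMappingTorusOf.of_diffeomorph_of_range_eq [IsManifold IT' ∞ T']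
    (hI : range IT' = range IT) {φ : M ≃ₘ⟮I, I⟯ M} (h : IsMappingTorusOf IT T φ)
    (e : T ≃ₘ⟮IT, IT'⟯ T') : IsMappingTorusOf IT' T' φ :=
  h.diffeomorph_comp e hI

/-- Transport of smooth mapping tori along diffeomorphisms between manifolds with boundaryless
models (closed manifolds: the setting of Cappell–Shaneson 1976, §1).
[cite: CappellShaneson1976, §1] -/
theorem IsMappingTorusOf.diffeomorph_comp_of_boundaryless [IT.Boundaryless] [IT'.Boundaryless]
    [IsManifold IT' ∞ T'] {φ : M ≃ₘ⟮I, I⟯ M} (h : IsMappingTorusOf IT T φ)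
    (e : T ≃ₘ⟮IT, IT'⟯ T') : IsMappingTorusOf IT' T' φ :=
  h.diffeomorph_comp e (by rw [IT.range_eq_univ, IT'.range_eq_univ])

/-- **The true instances of the named fact `IsMappingTorusOf.of_diffeomorph`.** For a fixed pair
of models with `range IT' = range IT` the fact holds as stated (by
`IsMappingTorusOf.diffeomorph_comp`); consumers carrying it as a hypothesis for such
models can be fed this term. (For two unrelated models it is presumably false, like the fact
`Literature.Topology.FourManifolds.IsOpenGluing.of_diffeomorph` its interim proof relied on, refuted in file
`OpenGluingCounterexample`.) [cite: CappellShaneson1976, §1] -/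
theorem IsMappingTorusOf.of_diffeomorph_holds_of_range_eq (hI : range IT' = range IT) :
    IsMappingTorusOf.of_diffeomorph (I := I) (IT := IT) (IT' := IT') (M := M) (T := T)
      (T' := T') :=
  fun h e => h.diffeomorph_comp e hI

/-- The named fact `IsMappingTorusOf.of_diffeomorph` holds for two manifolds with the SAME model
(`IT' = IT`). [cite: CappellShaneson1976, §1] -/
theorem IsMappingTorusOf.of_diffeomorph_holds_self {Q : Type*} [TopologicalSpace Q]
    [ChartedSpace HT Q] :
    IsMappingTorusOf.of_diffeomorph (I := I) (IT := IT) (IT' := IT) (M := M) (T := T) (T' := Q) :=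
  IsMappingTorusOf.of_diffeomorph_holds_of_range_eq rfl

/-- The named fact `IsMappingTorusOf.of_diffeomorph` holds for any two boundaryless models `IT`,
`IT'` on `ET`. [cite: CappellShaneson1976, §1] -/
theorem IsMappingTorusOf.of_diffeomorph_holds_of_boundaryless [IT.Boundaryless]
    [IT'.Boundaryless] :
    IsMappingTorusOf.of_diffeomorph (I := I) (IT := IT) (IT' := IT') (M := M) (T := T)
      (T' := T') :=
  IsMappingTorusOf.of_diffeomorph_holds_of_range_eq (by rw [IT.range_eq_univ, IT'.range_eq_univ])

end Literature.Topology.FourManifolds
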